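import Summits.Ventures.PercRepro.Night2DQm1Coloops

/-!
# PercRepro — the regime `|E ∖ G| = q − 1`: where the losses sit and how large they are (night-2, gen 19)

`M` simple loopless, `G` a rank-`(q+1)` flat with `|E ∖ G| = q − 1`, `K = coloops (M|G)`, `k = kColoops`,
`ρ := q + 1 − k` (the rank of `G ∖ K`).  Every thin member has request `≤ Φ/(q+1)` (`req_le_of_thin`) and every
set `S ⊆ G` has `capS S ≥ capDQ q k = 1 − kΦ/q` (`capS_ge_capDQ`).

* a shadow set with `|S ∖ K| ≥ ρ + 1` has at most `ρ − 2` thin preimages (`card_thin_coverPreimages_add_two_le`),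
  so `L1 S ≤ (ρ − 2)Φ/(q+1)` (`L1_le_of_card_ge_dqm1`) — and `(ρ − 2)Φ/(q+1) ≤ capDQ q k` always (`sub_two_mul_le_capDQ`);
* hence a thin member with `|B ∖ K| ≥ ρ` loses nothing (**`loss_eq_zero_of_card_ge_dqm1`**): the losses sit at the members
  `B = K ∪ T` with `T` a basis of a hyperplane of `G ∖ K` (`|T| = ρ − 1`);
* such a member loses at most `lambdaDQ q ρ k = Φ/(q+1) − capDQ q k / ρ` at any covering set (**`loss_le_lambdaDQ`**):
  the covering set `K ∪ T ∪ {z}` has at most `ρ` thin preimages (`L1_insert_le`).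
For `ρ = 3` this is the rigid chain (`loss_eq_zero_of_three_le`, `loss_le_lambda`); `ρ = 4, 5` are the `(7, 5)` cells
`(4, 2)` and `(4, 1)` (`proofs/NIGHT-2-g19.md` §1–§2).
-/

namespace PercRepro.Shadow

open Finset PerFlat ThmH

variable {α : Type*} [DecidableEq α] {M : Matroid α} [M.Finite]

/-- The minimal capacity left by layer 0 in the regime `|E ∖ G| = q − 1` with `k` coloops: `1 − kΦ/q`. -/
noncomputable def capDQ (q k : ℕ) : ℚ := 1 - (k : ℚ) * phiQ q / (q : ℚ)

/-- The loss bound of a hyperplane-basis member: `λ = Φ/(q+1) − capDQ/ρ`. -/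
noncomputable def lambdaDQ (q ρ k : ℕ) : ℚ := phiQ q / ((q : ℚ) + 1) - capDQ q k / (ρ : ℚ)

/-- `capS S ≥ 1 − kΦ/q` for every `S ⊆ G` when `|E ∖ G| = q − 1`. -/
theorem capS_ge_capDQ {q : ℕ} {G : Finset α} (hd : (gr M \ G).card = q - 1) (hq : 1 ≤ q) {S : Finset α}
    (hS : S ⊆ G) : capDQ q (kColoops M G) ≤ capS M q G S := by
  unfold capS capDQ
  have hk1 : (k1 M q G S : ℚ) ≤ (kColoops M G : ℚ) := by exact_mod_cast k1_le_kColoops hS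
  have hd1 : (1 : ℚ) + ((gr M \ G).card : ℚ) = (q : ℚ) := by
    rw [hd]; push_cast [Nat.cast_sub hq]; ring
  rw [hd1]
  have hpos : (0 : ℚ) < (q : ℚ) := by exact_mod_cast hq
  apply sub_le_sub_left
  apply div_le_div_of_nonneg_right _ hpos.le
  exact mul_le_mul_of_nonneg_right hk1 (phiQ_pos q).le

/-- `capDQ q k > 0` for `k ≤ q − 1`, `q ≥ 1`. -/
theorem capDQ_pos {q k : ℕ} (hq : 1 ≤ q) (hk : k + 1 ≤ q) : 0 < capDQ q k := by
  unfold capDQ phiQ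
  have hqq : (1 : ℚ) ≤ (q : ℚ) := by exact_mod_cast hq
  have hkq : (k : ℚ) + 1 ≤ (q : ℚ) := by exact_mod_cast hk
  have hk0 : (0 : ℚ) ≤ (k : ℚ) := by positivity
  have e : (k : ℚ) * (((q : ℚ) + 2) / ((q : ℚ) + 1)) / (q : ℚ) = (k : ℚ) * ((q : ℚ) + 2) / ((q : ℚ) * ((q : ℚ) + 1)) := by
    field_simp
  rw [sub_pos, e, div_lt_one (by positivity)]
  nlinarith

/-- The arithmetic of the no-loss bound: `(ρ − 2)Φ/(q+1) ≤ 1 − kΦ/q` when `k + ρ = q + 1`, `q ≥ 1`, `ρ ≥ 1`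
(the difference is `(ρ(q+2) − 2)/(q(q+1)²)`). -/
theorem sub_two_mul_le_capDQ {q ρ k : ℕ} (hk : k + ρ = q + 1) (hq : 1 ≤ q) (hρ : 1 ≤ ρ) :
    ((ρ : ℚ) - 2) * (phiQ q / ((q : ℚ) + 1)) ≤ capDQ q k := by
  unfold capDQ phiQ
  have hqq : (1 : ℚ) ≤ (q : ℚ) := by exact_mod_cast hq
  have hρρ : (1 : ℚ) ≤ (ρ : ℚ) := by exact_mod_cast hρ
  have hkρ : (k : ℚ) = (q : ℚ) + 1 - (ρ : ℚ) := by
    have : (k : ℚ) + (ρ : ℚ) = (q : ℚ) + 1 := by exact_mod_cast hk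
    linarith
  rw [hkρ]
  have hq0 : (q : ℚ) ≠ 0 := by positivity
  have hq1 : (q : ℚ) + 1 ≠ 0 := by positivity
  rw [← sub_nonneg]
  have e : 1 - ((q : ℚ) + 1 - (ρ : ℚ)) * (((q : ℚ) + 2) / ((q : ℚ) + 1)) / (q : ℚ) -
      ((ρ : ℚ) - 2) * (((q : ℚ) + 2) / ((q : ℚ) + 1) / ((q : ℚ) + 1)) =
      ((ρ : ℚ) * ((q : ℚ) + 2) - 2) / ((q : ℚ) * ((q : ℚ) + 1) ^ 2) := by
    field_simp
    ring
  rw [e]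
  apply div_nonneg _ (by positivity)
  nlinarith

/-- `lambdaDQ > 0` when `k + ρ = q + 1`, `ρ ≥ 1`, `q ≥ 1` (it equals `(2(q+1)² − ρ(q+2))/(q(q+1)²)`). -/
theorem lambdaDQ_pos {q ρ k : ℕ} (hk : k + ρ = q + 1) (hq : 1 ≤ q) (hρ : 1 ≤ ρ) : 0 < lambdaDQ q ρ k := by
  unfold lambdaDQ capDQ phiQ
  have hqq : (1 : ℚ) ≤ (q : ℚ) := by exact_mod_cast hq
  have hρρ : (1 : ℚ) ≤ (ρ : ℚ) := by exact_mod_cast hρ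
  have hkρ : (k : ℚ) = (q : ℚ) + 1 - (ρ : ℚ) := by
    have : (k : ℚ) + (ρ : ℚ) = (q : ℚ) + 1 := by exact_mod_cast hk
    linarith
  have hρq : (ρ : ℚ) ≤ (q : ℚ) + 1 := by
    have : ρ ≤ q + 1 := by omega
    exact_mod_cast this
  rw [hkρ]
  have hq0 : (q : ℚ) ≠ 0 := by positivity
  have hq1 : (q : ℚ) + 1 ≠ 0 := by positivity
  have hρ0 : (ρ : ℚ) ≠ 0 := by positivity
  have e : ((q : ℚ) + 2) / ((q : ℚ) + 1) / ((q : ℚ) + 1) -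
      (1 - ((q : ℚ) + 1 - (ρ : ℚ)) * (((q : ℚ) + 2) / ((q : ℚ) + 1)) / (q : ℚ)) / (ρ : ℚ) =
      (2 * ((q : ℚ) + 1) ^ 2 - (ρ : ℚ) * ((q : ℚ) + 2)) / ((q : ℚ) * ((q : ℚ) + 1) ^ 2 * (ρ : ℚ)) := by
    field_simp
    ring
  rw [e]
  apply div_pos _ (by positivity)
  nlinarith

open scoped Classical in
/-- `L1 S ≤ (ρ − 2)Φ/(q+1)` at a shadow set with `|S ∖ K| ≥ ρ + 1` (`|E ∖ G| = q − 1`, `M` simple loopless). -/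
theorem L1_le_of_card_ge_dqm1 {q ρ : ℕ} {G : Finset α} (hG : G ∈ flatsQ M (q + 1)) (hd : (gr M \ G).card = q - 1)
    (hk : kColoops M G + ρ = q + 1) (hs : ∀ e ∈ gr M, ∀ f ∈ gr M, e ≠ f → rkN M {e, f} = 2)
    (hl : ∀ e ∈ gr M, M.Indep {e}) {S : Finset α} (hS : S ∈ shadowAt M (q + 2) q (Uq M (q + 2) q) G)
    (hcard : ρ + 1 ≤ (S \ coloops M G).card) : L1 M q G S ≤ ((ρ : ℚ) - 2) * (phiQ q / ((q : ℚ) + 1)) := by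
  have hd' : (gr M \ G).card ≤ q := by omega
  unfold L1
  have hterm : ∀ B ∈ (coverPreimages M (Uq M (q + 2) q) G S).filter (fun B => B ∉ lay0 M q G),
      req M q B ≤ phiQ q / ((q : ℚ) + 1) := by
    intro B hB
    rw [Finset.mem_filter, mem_coverPreimages] at hB
    exact req_le_of_thin hG hd (mem_thinMembers.2 ⟨hB.1.1, hB.2⟩)
  have hcount := card_thin_coverPreimages_add_two_le hG hd' hk hs hl hS hcard
  calc ∑ B ∈ (coverPreimages M (Uq M (q + 2) q) G S).filter (fun B => B ∉ lay0 M q G), req M q B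
      ≤ ∑ _B ∈ (coverPreimages M (Uq M (q + 2) q) G S).filter (fun B => B ∉ lay0 M q G),
          phiQ q / ((q : ℚ) + 1) := Finset.sum_le_sum hterm
    _ = (((coverPreimages M (Uq M (q + 2) q) G S).filter (fun B => B ∉ lay0 M q G)).card : ℚ) *
          (phiQ q / ((q : ℚ) + 1)) := by rw [Finset.sum_const, nsmul_eq_mul]
    _ ≤ ((ρ : ℚ) - 2) * (phiQ q / ((q : ℚ) + 1)) := by
        apply mul_le_mul_of_nonneg_right _ (div_nonneg (phiQ_pos q).le (by positivity))
        have : (((coverPreimages M (Uq M (q + 2) q) G S).filter (fun B => B ∉ lay0 M q G)).card : ℚ) + 2 ≤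
            (ρ : ℚ) := by exact_mod_cast hcount
        linarith

open scoped Classical in
/-- The covering set `B ∪ {z}` of a thin member is a shadow set with closure `G`. -/
theorem insert_mem_shadowAt_thin {q : ℕ} {G : Finset α} (hG : G ∈ flatsQ M (q + 1)) {B : Finset α}
    (hB : B ∈ thinMembers M q G) {z : α} (hz : z ∈ G \ clF M B) :
    insert z B ∈ shadowAt M (q + 2) q (Uq M (q + 2) q) G := by
  have hB' : B ∈ membersIn M (Uq M (q + 2) q) G := (mem_thinMembers.1 hB).1
  have hBU : B ∈ Uq M (q + 2) q := (mem_membersIn.1 hB').1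
  have hBG : clF M B ⊆ G := (mem_membersIn.1 hB').2
  exact superset_mem_shadowAt hG hB' hz (le_refl _)
    (Finset.insert_subset (Finset.mem_sdiff.1 hz).1 ((subset_clF hBU).trans hBG))

open scoped Classical in
/-- `|(B ∪ {z}) ∖ K| = |B ∖ K| + 1` for a thin member and `z ∈ G ∖ cl B` (`|E ∖ G| ≤ q`). -/
theorem card_insert_sdiff_coloops_thin {q : ℕ} {G : Finset α} (hG : G ∈ flatsQ M (q + 1))
    (hd : (gr M \ G).card ≤ q) {B : Finset α} (hB : B ∈ thinMembers M q G) {z : α} (hz : z ∈ G \ clF M B) :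
    (insert z B \ coloops M G).card = (B \ coloops M G).card + 1 := by
  have hB' : B ∈ membersIn M (Uq M (q + 2) q) G := (mem_thinMembers.1 hB).1
  have hBU : B ∈ Uq M (q + 2) q := (mem_membersIn.1 hB').1
  have hzB : z ∉ B := notMem_of_notMem_clF hBU (Finset.mem_sdiff.1 hz).2
  have hK := coloops_subset_of_mem_thinMembers hG hd hB
  have hzK : z ∉ coloops M G := fun h => hzB (hK h)
  have e : insert z B \ coloops M G = insert z (B \ coloops M G) := by
    ext x
    simp only [Finset.mem_sdiff, Finset.mem_insert]
    constructor
    · rintro ⟨hx | hx, hxK⟩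
      · exact Or.inl hx
      · exact Or.inr ⟨hx, hxK⟩
    · rintro (rfl | ⟨hx, hxK⟩)
      · exact ⟨Or.inl rfl, hzK⟩
      · exact ⟨Or.inr hx, hxK⟩
  rw [e, Finset.card_insert_of_notMem (fun h => hzB (Finset.mem_sdiff.1 h).1)]

open scoped Classical in
/-- **A thin member with `|B ∖ K| ≥ ρ` loses nothing at any covering set** (`|E ∖ G| = q − 1`, `kColoops + ρ = q + 1`,
`M` simple loopless). -/
theorem loss_eq_zero_of_card_ge_dqm1 {q ρ : ℕ} {G : Finset α} (hG : G ∈ flatsQ M (q + 1))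
    (hd : (gr M \ G).card = q - 1) (hk : kColoops M G + ρ = q + 1)
    (hρ : 1 ≤ ρ) (hs : ∀ e ∈ gr M, ∀ f ∈ gr M, e ≠ f → rkN M {e, f} = 2) (hl : ∀ e ∈ gr M, M.Indep {e})
    {B : Finset α} (hB : B ∈ thinMembers M q G) (hcard : ρ ≤ (B \ coloops M G).card) {z : α}
    (hz : z ∈ G \ clF M B) : loss M q G B z = 0 := by
  have hd' : (gr M \ G).card ≤ q := by omega
  have hq1 : 1 ≤ q := le_trans (one_le_card_compl_of_member hG (mem_membersIn.1 (mem_thinMembers.1 hB).1).1) hd'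
  have hSG : insert z B ⊆ G := subset_G_of_mem_shadowAt (insert_mem_shadowAt_thin hG hB hz)
  have hL : L1 M q G (insert z B) ≤ capS M q G (insert z B) := by
    have h1 := L1_le_of_card_ge_dqm1 hG hd hk hs hl (insert_mem_shadowAt_thin hG hB hz)
      (by rw [card_insert_sdiff_coloops_thin hG hd' hB hz]; omega)
    exact h1.trans ((sub_two_mul_le_capDQ hk hq1 hρ).trans (capS_ge_capDQ hd hq1 hSG))
  unfold loss fS
  rw [if_pos hL]
  ring

open scoped Classical in
/-- **A hyperplane-basis member `|B ∖ K| = ρ − 1` loses at most `lambdaDQ` at any covering set.** -/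
theorem loss_le_lambdaDQ {q ρ : ℕ} {G : Finset α} (hG : G ∈ flatsQ M (q + 1))
    (hd : (gr M \ G).card = q - 1) (hk : kColoops M G + ρ = q + 1) (hρ : 2 ≤ ρ) {B : Finset α}
    (hB : B ∈ thinMembers M q G) (hcard : (B \ coloops M G).card + 1 = ρ) {z : α} (hz : z ∈ G \ clF M B) :
    loss M q G B z ≤ lambdaDQ q ρ (kColoops M G) := by
  have hd' : (gr M \ G).card ≤ q := by omega
  have hq1 : 1 ≤ q := le_trans (one_le_card_compl_of_member hG (mem_membersIn.1 (mem_thinMembers.1 hB).1).1) hd'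
  have hSG : insert z B ⊆ G := subset_G_of_mem_shadowAt (insert_mem_shadowAt_thin hG hB hz)
  set Φ' : ℚ := phiQ q / ((q : ℚ) + 1) with hΦ'
  set c : ℚ := capDQ q (kColoops M G) with hc
  have hΦ'pos : 0 < Φ' := div_pos (phiQ_pos q) (by positivity)
  have hcpos : 0 < c := capDQ_pos hq1 (by omega)
  have hρpos : (0 : ℚ) < (ρ : ℚ) := by exact_mod_cast (by omega : 0 < ρ)
  have hreq : req M q B ≤ Φ' := req_le_of_thin hG hd hB
  have hreq0 : 0 ≤ req M q B := req_nonneg q B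
  have hL1 : L1 M q G (insert z B) ≤ (ρ : ℚ) * Φ' := by
    have := L1_insert_le hG hd hB hz
    have hρ' : ((B \ coloops M G).card : ℚ) + 1 = (ρ : ℚ) := by exact_mod_cast hcard
    rw [hρ'] at this
    exact this
  have hcap : c ≤ capS M q G (insert z B) := capS_ge_capDQ hd hq1 hSG
  unfold loss fS
  split_ifs with hle
  · simp only [sub_self, mul_zero]
    exact (lambdaDQ_pos hk hq1 (by omega)).le
  · push Not at hle
    have hLpos : 0 < L1 M q G (insert z B) := hcpos.trans (hcap.trans_lt hle)
    have hfrac : c / ((ρ : ℚ) * Φ') ≤ capS M q G (insert z B) / L1 M q G (insert z B) := by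
      rw [div_le_div_iff₀ (by positivity) hLpos]
      calc c * L1 M q G (insert z B) ≤ c * ((ρ : ℚ) * Φ') := mul_le_mul_of_nonneg_left hL1 hcpos.le
        _ ≤ capS M q G (insert z B) * ((ρ : ℚ) * Φ') := mul_le_mul_of_nonneg_right hcap (by positivity)
    have h1 : 1 - capS M q G (insert z B) / L1 M q G (insert z B) ≤ 1 - c / ((ρ : ℚ) * Φ') := by linarith
    have h1' : 0 ≤ 1 - capS M q G (insert z B) / L1 M q G (insert z B) := by
      rw [sub_nonneg, div_le_one hLpos]; exact hle.le
    calc req M q B * (1 - capS M q G (insert z B) / L1 M q G (insert z B))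
        ≤ Φ' * (1 - c / ((ρ : ℚ) * Φ')) := mul_le_mul hreq h1 h1' hΦ'pos.le
      _ = lambdaDQ q ρ (kColoops M G) := by
          unfold lambdaDQ
          rw [← hΦ', ← hc]
          field_simp

end PercRepro.Shadow
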